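import Literature.MathematicalPhysics.KineticTheory.LangevinChainFlowBounds
import Mathlib.Algebra.Order.Chebyshev
import HarnessLib

/-!
# The pathwise energy identity of the Langevin-driven pinned chain

Trunk T-KINETIC (Literature/MathematicalPhysics/KineticTheory). Cuneo–Eckmann–Hairer–Rey-Bellet,
EJP 23 (2018) no. 55, proof of Lemma 5.5 (p. 21 of arXiv:1712.09413): "By applying the Itô formula
to `H(z_t)`, we find … `H(z_t) - H(z_0) = ∑_b γ_b T_b t - Γ(t) + M_t`" with the **dissipation
integral** `Γ(t) = ∑_{b ∈ B} γ_b ∫₀ᵗ p_b²(s) ds` (their (5.2)) and the martingale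
`M_t = ∫₀ᵗ ∑_b √(2γ_bT_b) p_b dW_b`. For the chain driven by a CONTINUOUS momentum-noise path `η`
(the pathwise flow `OscillatorChain.chainFlow` of `LangevinChainSDE.lean`, `z(t) = x + (0, η(t)) +
∫₀ᵗ Y(z(s)) ds`) the same identity holds PATH BY PATH, with the stochastic integral replaced by the
pathwise "work of the noise"

  `𝓜_t = ∑_i ( A_i(t) η_i(t) - ∫₀ᵗ η_i(s) A_i'(s) ds + η_i(t)²/2 )`,  `A_i = p_i - η_i`
  (`A_i' = Y(z)_{p,i}`; formally `𝓜_t = ∫ p dη` integrated by parts, `= M_t + ½[η]_t` for Brownian `η`):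

* `OscillatorChain.fderiv_hamiltonian_drift_eq` — the algebra `DH(y)·Y(y + (0,e)) =
  -∑_i e_i Y(y+(0,e))_{p,i} - γ ∑_i w_i (p_i + e_i)²` (exact form of the one-sided bounds of
  `LangevinChainSDE.lean` / `LangevinChainFlowBounds.lean`).
* `OscillatorChain.dissipation`, `OscillatorChain.noiseWork` — `Γ_t = γ ∫₀ᵗ ∑_i w_i p_i(s)² ds`
  (`w_i = [i=0] + [i=N-1]` the bath weights) and `𝓜_t`, as functionals of `(x, η, t)`.
* `pinnedChain_hamiltonian_chainFlow_eq` — **the energy identity `H(z(t)) = H(x) + 𝓜_t - Γ_t`**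
  for every continuous `η` and `t ≥ 0` (chain rule for `H ∘ (z - (0,η))` and the fundamental
  theorem of calculus; no probability).
* `pinnedChain_hamiltonian_chainFlow_le_of_noise` — an **energy-jump bound**: with
  `A = (1 + H(x)) e^{C M t} - 1`, `H(z(t)) ≤ A + M √(2 N A) + N M²/2` when `‖η‖ ≤ M` on `[0, T]`
  (the upper Grönwall bound of `LangevinChainFlowBounds.lean` plus the momentum shift).

These are the deterministic inputs of the exponential-supermartingale estimate (CEHR Lemma 5.5) and
of the high-energy analysis of CEHR §5 for the constructed transition semigroup.

## References

* N. Cuneo, J.-P. Eckmann, M. Hairer, L. Rey-Bellet, *Non-equilibrium steady states for networks of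
  oscillators*, EJP 23 (2018) no. 55 (arXiv:1712.09413), §5 eq. (5.2), Lemma 5.5 and its proof.
* R. Khasminskii, *Stochastic Stability of Differential Equations* (2nd ed., 2012), §3.4.
-/

noncomputable section

open MeasureTheory Filter Topology Set Metric
open scoped NNReal

namespace Literature.MathematicalPhysics.KineticTheory.HeatConduction

open OscillatorChain

variable {N : ℕ}

/-- The bath weights `w_i = [i=0] + [i=N-1]` are nonnegative. [folklore] -/
theorem bathWeight_nonneg (N : ℕ) (i : Fin N) : 0 ≤ bathWeight N i := by
  unfold bathWeight; split_ifs <;> norm_num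

/-- The bath weights are at most `2`. [folklore] -/
theorem bathWeight_le_two (N : ℕ) (i : Fin N) : bathWeight N i ≤ 2 := by
  unfold bathWeight; split_ifs <;> norm_num

/-! ### The exact energy identity for the drift, and the two path functionals -/

namespace OscillatorChain

variable (P : OscillatorChain)

/-- **The energy identity, exact form**: for the Langevin drift `Y` and a momentum perturbation
`e`, `DH(y)·Y(y + (0, e)) = -∑_i e_i Y(y + (0,e))_{p,i} - γ ∑_i w_i (p_i + e_i)²`
(`w_i = [i=0]+[i=N-1]`). [cite: CuneoEckmannHairerReyBellet2018, §3 eq. (3.3)] -/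
theorem fderiv_hamiltonian_drift_eq (hH : Differentiable ℝ (P.hamiltonian N)) (y : PhaseSpace N)
    (e : Fin N → ℝ) :
    fderiv ℝ (P.hamiltonian N) y (P.drift N (y.1, y.2 + e)) =
      -(∑ i, e i * (P.drift N (y.1, y.2 + e)).2 i) -
        P.γ * ∑ i, bathWeight N i * (y.2 i + e i) ^ 2 := by
  rw [P.fderiv_hamiltonian_apply hH]
  simp only [drift, P.partialQ_hamiltonian_fst, Pi.add_apply]
  rw [Finset.mul_sum, ← Finset.sum_neg_distrib, ← Finset.sum_sub_distrib]
  refine Finset.sum_congr rfl fun i _ => ?_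
  ring

/-- The **dissipation functional** `Γ_t = γ ∫₀ᵗ ∑_i w_i p_i(s)² ds` of the flow `z = chainFlow x η`
(CEHR (5.2): `Γ(t) = ∑_{b∈B} γ_b ∫₀ᵗ p_b²(s) ds`; for the path graph `B = {0, N-1}`, `γ_b = γ`,
and for `N = 1` both baths act on the single site, weight `2`).
[cite: CuneoEckmannHairerReyBellet2018, §5 eq. (5.2)] -/
def dissipation (N : ℕ) (x : PhaseSpace N) (η : ℝ → Fin N → ℝ) (t : ℝ) : ℝ :=
  P.γ * ∫ s in (0 : ℝ)..t, ∑ i, bathWeight N i * (P.chainFlow N x η s).2 i ^ 2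

/-- The **work of the noise** `𝓜_t = ∑_i (A_i(t) η_i(t) - ∫₀ᵗ η_i(s) A_i'(s) ds + η_i(t)²/2)`,
`A_i = p_i - η_i` (so `A_i' = Y(z)_{p,i}`): the pathwise form of CEHR's `M_t + ∑_b γ_bT_b t`
(for the Brownian noise `η_b = √(2γ_bT_b) W_b` it is the Itô integral `∫ p dη` plus its
compensator `½[η]_t`). [cite: CuneoEckmannHairerReyBellet2018, Lemma 5.5 (proof)] -/
def noiseWork (N : ℕ) (x : PhaseSpace N) (η : ℝ → Fin N → ℝ) (t : ℝ) : ℝ :=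
  ∑ i, (((P.chainFlow N x η t).2 i - η t i) * η t i -
    (∫ s in (0 : ℝ)..t, η s i * (P.drift N (P.chainFlow N x η s)).2 i) + η t i ^ 2 / 2)

/-- `Γ_0 = 0`. [folklore] -/
@[simp] theorem dissipation_zero (N : ℕ) (x : PhaseSpace N) (η : ℝ → Fin N → ℝ) :
    P.dissipation N x η 0 = 0 := by
  simp [dissipation]

end OscillatorChain

/-! ### The energy identity along the flow of the pinned chain -/

section Pinned

variable {ω₂ lam β γ : ℝ} (hω : 0 < ω₂) (hl : 0 ≤ lam) (hβ : 0 ≤ β) (hγ : 0 ≤ γ) (N : ℕ)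
include hω hl hβ hγ

/-- **The pathwise energy identity** (CEHR, proof of Lemma 5.5: "`H(z_t) - H(z_0) =
∑_b γ_bT_b t - Γ(t) + M_t`", here path by path): for the flow `z = chainFlow x η` of the pinned
chain (`ω₂ > 0`, `lam, β, γ ≥ 0`) driven by a continuous noise path `η`,
`H(z(t)) = H(x) + 𝓜_t - Γ_t` for `t ≥ 0` (for `η(0) ≠ 0` the flow starts at `x + (0, η(0))` and
`𝓜_0 = H(x + (0,η(0))) - H(x)` accounts for it). Proof: `y = z - (0, η)` is `C¹` with `y' = Y(z)`;
`H(z) = H(y) + ∑_i (A_i η_i + η_i²/2)` (`A = y_p`); `(H∘y)' = DH(y)·Y(y + (0,η)) =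
-∑ η_i A_i' - γ∑ w_i p_i²`; integrate. [cite: CuneoEckmannHairerReyBellet2018, Lemma 5.5 (proof)] -/
theorem pinnedChain_hamiltonian_chainFlow_eq (x : PhaseSpace N) {η : ℝ → Fin N → ℝ}
    (hη : Continuous η) {t : ℝ} (ht : 0 ≤ t) :
    (pinnedChain ω₂ lam β γ).hamiltonian N ((pinnedChain ω₂ lam β γ).chainFlow N x η t) =
      (pinnedChain ω₂ lam β γ).hamiltonian N x + (pinnedChain ω₂ lam β γ).noiseWork N x η t -
        (pinnedChain ω₂ lam β γ).dissipation N x η t := by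
  set P := pinnedChain ω₂ lam β γ with hP
  set H := P.hamiltonian N with hHdef
  set Y := P.drift N with hYdef
  set z := P.chainFlow N x η with hzdef
  have hYc : Continuous Y := (pinnedChain_contDiff_drift ω₂ lam β γ N (n := 0)).continuous
  have hzc : Continuous z := pinnedChain_continuous_chainFlow hω hl hβ hγ N x hη
  have hz_eq : ∀ s ∈ Icc 0 t, z s = forcing x η s + ∫ r in (0 : ℝ)..s, Y (z r) :=
    pinnedChain_isIntegralSolutionOn_chainFlow hω hl hβ hγ N x hη t
  have hHs : ContDiff ℝ 1 H := pinnedChain_contDiff_hamiltonian ω₂ lam β γ N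
  have hHd : Differentiable ℝ H := hHs.differentiable one_ne_zero
  have hHfc : Continuous (fderiv ℝ H) := hHs.continuous_fderiv one_ne_zero
  -- `y(t) = x + ∫₀ᵗ Y(z)`, `y' = Y(z)`, `y = z - (0, η)` on `[0, t]`
  set y : ℝ → PhaseSpace N := fun s => x + ∫ r in (0 : ℝ)..s, Y (z r) with hydef
  have hy_deriv : ∀ s, HasDerivAt y (Y (z s)) s := fun s => by
    have h1 : HasDerivAt (fun u => ∫ r in (0 : ℝ)..u, Y (z r)) (Y (z s)) s :=
      ((hYc.comp hzc).integral_hasStrictDerivAt 0 s).hasDerivAt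
    exact h1.const_add x
  have hyc : Continuous y := continuous_iff_continuousAt.2 fun s => (hy_deriv s).continuousAt
  have hy_eq : ∀ s ∈ Icc 0 t, y s = z s - ((0 : Fin N → ℝ), η s) := fun s hs => by
    rw [hz_eq s hs]
    simp only [hydef, forcing]
    abel
  have hz_y : ∀ s ∈ Icc 0 t, z s = ((y s).1, (y s).2 + η s) := fun s hs => by
    rw [hy_eq s hs]; ext i <;> simp
  have hy0 : y 0 = x := by simp [hydef]
  -- the chain rule for `H ∘ y` and the fundamental theorem of calculus
  have hg_deriv : ∀ s, HasDerivAt (fun s => H (y s)) (fderiv ℝ H (y s) (Y (z s))) s := fun s =>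
    (hHd (y s)).hasFDerivAt.comp_hasDerivAt s (hy_deriv s)
  have hg_cont : Continuous fun s => fderiv ℝ H (y s) (Y (z s)) :=
    (hHfc.comp hyc).clm_apply (hYc.comp hzc)
  have hFTC : ∫ s in (0 : ℝ)..t, fderiv ℝ H (y s) (Y (z s)) = H (y t) - H x := by
    rw [intervalIntegral.integral_eq_sub_of_hasDerivAt (fun s _ => hg_deriv s)
      (hg_cont.intervalIntegrable _ _), hy0]
  -- the integrand on `[0, t]`: `DH(y)·Y(z) = -∑ η_i Y(z)_{p,i} - γ ∑ w_i p_i²`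
  have hintegrand : ∀ s ∈ uIcc 0 t, fderiv ℝ H (y s) (Y (z s)) =
      -(∑ i, η s i * (Y (z s)).2 i) - γ * ∑ i, bathWeight N i * (z s).2 i ^ 2 := by
    intro s hs
    rw [uIcc_of_le ht] at hs
    have h := P.fderiv_hamiltonian_drift_eq hHd (y s) (η s)
    rw [← hz_y s hs] at h
    rw [h]
    congr 1
    rw [hz_y s hs]
    rfl
  have hI1 : IntervalIntegrable (fun s => ∑ i, η s i * (Y (z s)).2 i) volume 0 t := by
    refine (continuous_finsetSum _ fun i _ => ?_).intervalIntegrable _ _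
    exact ((continuous_apply i).comp hη).mul
      ((continuous_apply i).comp (continuous_snd.comp (hYc.comp hzc)))
  have hI2 : IntervalIntegrable (fun s => ∑ i, bathWeight N i * (z s).2 i ^ 2) volume 0 t := by
    refine (continuous_finsetSum _ fun i _ => ?_).intervalIntegrable _ _
    exact continuous_const.mul (((continuous_apply i).comp (continuous_snd.comp hzc)).pow 2)
  have hsplit : ∫ s in (0 : ℝ)..t, fderiv ℝ H (y s) (Y (z s)) =
      -(∑ i, ∫ s in (0 : ℝ)..t, η s i * (Y (z s)).2 i) -
        γ * ∫ s in (0 : ℝ)..t, ∑ i, bathWeight N i * (z s).2 i ^ 2 := by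
    have hI1' : IntervalIntegrable (fun s => -(∑ i, η s i * (Y (z s)).2 i)) volume 0 t := hI1.neg
    have hI2' : IntervalIntegrable (fun s => γ * ∑ i, bathWeight N i * (z s).2 i ^ 2) volume 0 t :=
      hI2.const_mul γ
    rw [intervalIntegral.integral_congr hintegrand, intervalIntegral.integral_sub hI1' hI2',
      intervalIntegral.integral_neg, intervalIntegral.integral_const_mul,
      intervalIntegral.integral_finsetSum]
    intro i _
    exact (((continuous_apply i).comp hη).mul
      ((continuous_apply i).comp (continuous_snd.comp (hYc.comp hzc)))).intervalIntegrable _ _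
  -- `H(z t) = H(y t) + ∑ (A_i η_i + η_i²/2)`
  have hHz : H (z t) = H (y t) + ∑ i, ((y t).2 i * η t i + η t i ^ 2 / 2) := by
    rw [hz_y t ⟨ht, le_rfl⟩]
    exact P.hamiltonian_add_momentum N (y t) (η t)
  have hA : ∀ i, (y t).2 i = (z t).2 i - η t i := fun i => by
    rw [hy_eq t ⟨ht, le_rfl⟩]; simp
  -- assemble
  have hW : P.noiseWork N x η t = ∑ i, (((z t).2 i - η t i) * η t i -
      (∫ s in (0 : ℝ)..t, η s i * (Y (z s)).2 i) + η t i ^ 2 / 2) := rfl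
  have hD : P.dissipation N x η t = γ * ∫ s in (0 : ℝ)..t, ∑ i, bathWeight N i * (z s).2 i ^ 2 := rfl
  rw [hW, hD, hHz, Finset.sum_congr rfl fun i _ => by rw [hA i]]
  have hsum : ∑ i, (((z t).2 i - η t i) * η t i -
      (∫ s in (0 : ℝ)..t, η s i * (Y (z s)).2 i) + η t i ^ 2 / 2) =
      ∑ i, (((z t).2 i - η t i) * η t i + η t i ^ 2 / 2) -
        ∑ i, ∫ s in (0 : ℝ)..t, η s i * (Y (z s)).2 i := by
    rw [← Finset.sum_sub_distrib]
    exact Finset.sum_congr rfl fun i _ => by ring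
  rw [hsum]
  linarith [hFTC, hsplit]

/-- The dissipation functional is nonnegative and nondecreasing in time (`γ ≥ 0`). [folklore] -/
theorem pinnedChain_dissipation_mono (x : PhaseSpace N) {η : ℝ → Fin N → ℝ} (hη : Continuous η)
    {s t : ℝ} (hst : s ≤ t) :
    (pinnedChain ω₂ lam β γ).dissipation N x η s ≤ (pinnedChain ω₂ lam β γ).dissipation N x η t := by
  unfold OscillatorChain.dissipation
  have hzc := pinnedChain_continuous_chainFlow hω hl hβ hγ N x hη
  have hc : Continuous fun r => ∑ i, bathWeight N i * ((pinnedChain ω₂ lam β γ).chainFlow N x η r).2 i ^ 2 := by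
    refine continuous_finsetSum _ fun i _ => ?_
    exact continuous_const.mul (((continuous_apply i).comp (continuous_snd.comp hzc)).pow 2)
  have hnn : ∀ r, 0 ≤ ∑ i, bathWeight N i * ((pinnedChain ω₂ lam β γ).chainFlow N x η r).2 i ^ 2 :=
    fun r => Finset.sum_nonneg fun i _ => mul_nonneg (bathWeight_nonneg N i) (sq_nonneg _)
  refine mul_le_mul_of_nonneg_left ?_ hγ
  rw [← intervalIntegral.integral_add_adjacent_intervals (hc.intervalIntegrable 0 s)
    (hc.intervalIntegrable s t)]
  have : 0 ≤ ∫ r in s..t, ∑ i, bathWeight N i * ((pinnedChain ω₂ lam β γ).chainFlow N x η r).2 i ^ 2 :=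
    intervalIntegral.integral_nonneg hst fun r _ => hnn r
  linarith

/-- `Γ_t ≥ 0` for `t ≥ 0` (`γ ≥ 0`). [folklore] -/
theorem pinnedChain_dissipation_nonneg (x : PhaseSpace N) {η : ℝ → Fin N → ℝ} (hη : Continuous η)
    {t : ℝ} (ht : 0 ≤ t) : 0 ≤ (pinnedChain ω₂ lam β γ).dissipation N x η t := by
  have h := pinnedChain_dissipation_mono hω hl hβ hγ N x hη ht
  rwa [OscillatorChain.dissipation_zero] at h

/-- **Additivity of the dissipation along the cocycle**: for `s, t ≥ 0`,
`Γ_{s+t}(x, η) = Γ_s(x, η) + Γ_t(z(s), η(s + ·) - η(s))`. [folklore] -/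
theorem pinnedChain_dissipation_add (x : PhaseSpace N) {η : ℝ → Fin N → ℝ} (hη : Continuous η)
    {s t : ℝ} (hs : 0 ≤ s) (ht : 0 ≤ t) :
    (pinnedChain ω₂ lam β γ).dissipation N x η (s + t) =
      (pinnedChain ω₂ lam β γ).dissipation N x η s +
        (pinnedChain ω₂ lam β γ).dissipation N ((pinnedChain ω₂ lam β γ).chainFlow N x η s)
          (fun r => η (s + r) - η s) t := by
  unfold OscillatorChain.dissipation
  set P := pinnedChain ω₂ lam β γ with hP
  have hη' : Continuous fun r => η (s + r) - η s := (hη.comp (continuous_const_add s)).sub continuous_const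
  have hzc := pinnedChain_continuous_chainFlow hω hl hβ hγ N x hη
  set g : ℝ → ℝ := fun r => ∑ i, bathWeight N i * (P.chainFlow N x η r).2 i ^ 2 with hg
  have hc : Continuous g := by
    refine continuous_finsetSum _ fun i _ => ?_
    exact continuous_const.mul (((continuous_apply i).comp (continuous_snd.comp hzc)).pow 2)
  rw [← mul_add]
  congr 1
  rw [← intervalIntegral.integral_add_adjacent_intervals (hc.intervalIntegrable 0 s)
    (hc.intervalIntegrable s (s + t))]
  congr 1
  -- substitute `r = s + u` and use the cocycle property on `[0, t]`
  have hsub : ∫ r in s..s + t, g r = ∫ u in (0 : ℝ)..t, g (s + u) := by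
    rw [intervalIntegral.integral_comp_add_left g s]
    simp
  rw [hsub]
  refine intervalIntegral.integral_congr fun u hu => ?_
  rw [uIcc_of_le ht] at hu
  simp only [hg]
  rw [pinnedChain_chainFlow_add hω hl hβ hγ N x hη hs hu.1]

/-! ### An energy-jump bound over short noisy stretches -/

omit hγ in
/-- `∑_i |p_i| ≤ √(2 N H)` for the pinned chain (`U, V ≥ 0`). [folklore] -/
theorem pinnedChain_sum_abs_momentum_le_sqrt (x : PhaseSpace N) :
    ∑ i, |x.2 i| ≤ Real.sqrt (2 * N * (pinnedChain ω₂ lam β γ).hamiltonian N x) := by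
  have h1 : (∑ i, |x.2 i|) ^ 2 ≤ N * ∑ i, |x.2 i| ^ 2 := by
    have := sq_sum_le_card_mul_sum_sq (s := (Finset.univ : Finset (Fin N))) (f := fun i => |x.2 i|)
    simpa using this
  have h2 : ∑ i, |x.2 i| ^ 2 = ∑ i, x.2 i ^ 2 := Finset.sum_congr rfl fun i _ => sq_abs _
  have h3 := pinnedChain_sum_sq_le_two_mul_hamiltonian hω hl hβ N (γ := γ) x
  refine Real.le_sqrt_of_sq_le ?_
  calc (∑ i, |x.2 i|) ^ 2 ≤ N * ∑ i, x.2 i ^ 2 := by rw [← h2]; exact h1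
    _ ≤ N * (2 * (pinnedChain ω₂ lam β γ).hamiltonian N x) :=
        mul_le_mul_of_nonneg_left h3 (Nat.cast_nonneg N)
    _ = 2 * N * (pinnedChain ω₂ lam β γ).hamiltonian N x := by ring

/-- **Energy-jump bound**: for the flow of the pinned chain driven by a continuous noise path with
`‖η‖ ≤ M` on `[0, T]`, and `t ∈ [0, T]`: with `A = (1 + H(x)) e^{C M t} - 1`
(`C = pinnedChainEnergyConst`) one has `H(z(t)) ≤ A + M √(2 N A) + N M²/2` — the noise-free part
`y = z - (0,η)` has `H(y(t)) ≤ A` (`pinnedChain_hamiltonian_chainFlow_le`) and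
`H(y + (0,η)) = H(y) + ∑ (p_i η_i + η_i²/2) ≤ H(y) + M ∑|p_i| + N M²/2`. [folklore] -/
theorem pinnedChain_hamiltonian_chainFlow_le_of_noise (x : PhaseSpace N) {η : ℝ → Fin N → ℝ}
    (hη : Continuous η) {T M : ℝ} (hM : ∀ t ∈ Icc 0 T, ‖η t‖ ≤ M) {t : ℝ} (ht : t ∈ Icc 0 T) :
    (pinnedChain ω₂ lam β γ).hamiltonian N ((pinnedChain ω₂ lam β γ).chainFlow N x η t) ≤
      ((1 + (pinnedChain ω₂ lam β γ).hamiltonian N x) *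
          Real.exp (pinnedChainEnergyConst ω₂ lam β γ N * M * t) - 1) +
        M * Real.sqrt (2 * N * ((1 + (pinnedChain ω₂ lam β γ).hamiltonian N x) *
          Real.exp (pinnedChainEnergyConst ω₂ lam β γ N * M * t) - 1)) +
        N * M ^ 2 / 2 := by
  set P := pinnedChain ω₂ lam β γ with hP
  set z := P.chainFlow N x η with hz
  set y : PhaseSpace N := z t - ((0 : Fin N → ℝ), η t) with hy
  set A := (1 + P.hamiltonian N x) * Real.exp (pinnedChainEnergyConst ω₂ lam β γ N * M * t) - 1 with hA
  have hM0 : 0 ≤ M := (norm_nonneg _).trans (hM 0 ⟨le_rfl, ht.1.trans ht.2⟩)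
  have hyA : P.hamiltonian N y ≤ A := by
    have h := pinnedChain_hamiltonian_chainFlow_le hω hl hβ hγ N x hη hM t ht
    simp only [hA, hy, hz]
    linarith
  have hy0 : 0 ≤ P.hamiltonian N y := pinnedChain_hamiltonian_nonneg hω.le hl hβ γ N y
  have hzy : z t = (y.1, y.2 + η t) := by ext i <;> simp [hy]
  rw [hzy, P.hamiltonian_add_momentum N y (η t)]
  have hηi : ∀ i, |η t i| ≤ M := fun i => by
    rw [← Real.norm_eq_abs]; exact (norm_le_pi_norm (η t) i).trans (hM t ht)
  have h1 : ∑ i, (y.2 i * η t i + η t i ^ 2 / 2) ≤ M * ∑ i, |y.2 i| + N * M ^ 2 / 2 := by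
    have hterm : ∀ i, y.2 i * η t i + η t i ^ 2 / 2 ≤ M * |y.2 i| + M ^ 2 / 2 := fun i => by
      have ha : y.2 i * η t i ≤ M * |y.2 i| := by
        calc y.2 i * η t i ≤ |y.2 i * η t i| := le_abs_self _
          _ = |y.2 i| * |η t i| := abs_mul _ _
          _ ≤ |y.2 i| * M := mul_le_mul_of_nonneg_left (hηi i) (abs_nonneg _)
          _ = M * |y.2 i| := mul_comm _ _
      have hb : η t i ^ 2 / 2 ≤ M ^ 2 / 2 := by
        have := hηi i
        have h' : η t i ^ 2 ≤ M ^ 2 := by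
          rw [← sq_abs]; exact pow_le_pow_left₀ (abs_nonneg _) this 2
        linarith
      linarith
    calc ∑ i, (y.2 i * η t i + η t i ^ 2 / 2) ≤ ∑ i, (M * |y.2 i| + M ^ 2 / 2) :=
          Finset.sum_le_sum fun i _ => hterm i
      _ = M * ∑ i, |y.2 i| + N * M ^ 2 / 2 := by
          rw [Finset.sum_add_distrib, Finset.mul_sum, Finset.sum_const, Finset.card_univ,
            Fintype.card_fin]
          simp only [nsmul_eq_mul]
          ring
  have h2 : ∑ i, |y.2 i| ≤ Real.sqrt (2 * N * A) := by
    refine (pinnedChain_sum_abs_momentum_le_sqrt hω hl hβ N (γ := γ) y).trans ?_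
    exact Real.sqrt_le_sqrt (by nlinarith [Nat.cast_nonneg (α := ℝ) N])
  have h3 : M * ∑ i, |y.2 i| ≤ M * Real.sqrt (2 * N * A) := mul_le_mul_of_nonneg_left h2 hM0
  linarith

/-! ### Measurable dependence on a parametrised start and noise -/

omit hω hl hβ hγ in
/-- A parametrised interval integral `w ↦ ∫₀ᵗ u(s, w) ds` of an integrand continuous in `s` and
measurable in `w` is measurable. [folklore] -/
theorem measurable_intervalIntegral_of_continuous_of_measurable {Ω : Type*} {mΩ : MeasurableSpace Ω}
    {u : ℝ → Ω → ℝ} (hc : ∀ w, Continuous fun s => u s w) (hm : ∀ s, Measurable (u s)) (t : ℝ) :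
    Measurable fun w => ∫ s in (0 : ℝ)..t, u s w := by
  have hU : Measurable (Function.uncurry u) := measurable_uncurry_of_continuous_of_measurable hc hm
  have h1 : ∀ a b : ℝ, Measurable fun w => ∫ s in Ioc a b, u s w := fun a b =>
    (hU.stronglyMeasurable.integral_prod_left (μ := volume.restrict (Ioc a b))).measurable
  simp only [intervalIntegral]
  exact (h1 0 t).sub (h1 t 0)

/-- **The dissipation functional depends measurably on a measurably parametrised start and noise
path** (continuous in time for every parameter). [folklore] -/
theorem pinnedChain_measurable_dissipation {Ω : Type*} {mΩ : MeasurableSpace Ω} {X : Ω → PhaseSpace N}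
    (hX : Measurable X) {G : Ω → ℝ → Fin N → ℝ} (hGc : ∀ w, Continuous (G w))
    (hGm : ∀ t, Measurable fun w => G w t) (t : ℝ) :
    Measurable fun w => (pinnedChain ω₂ lam β γ).dissipation N (X w) (G w) t := by
  unfold OscillatorChain.dissipation
  refine Measurable.const_mul ?_ _
  have hflow := fun s => pinnedChain_measurable_chainFlow hω hl hβ hγ N hX hGc hGm s
  refine measurable_intervalIntegral_of_continuous_of_measurable (fun w => ?_) (fun s => ?_) t
  · have hzc := pinnedChain_continuous_chainFlow hω hl hβ hγ N (X w) (hGc w)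
    exact continuous_finsetSum _ fun i _ =>
      continuous_const.mul (((continuous_apply i).comp (continuous_snd.comp hzc)).pow 2)
  · exact Finset.measurable_sum _ fun i _ =>
      (((measurable_pi_apply i).comp (measurable_snd.comp (hflow s))).pow_const 2).const_mul _

/-- **The work of the noise depends measurably on a measurably parametrised start and noise
path.** [folklore] -/
theorem pinnedChain_measurable_noiseWork {Ω : Type*} {mΩ : MeasurableSpace Ω} {X : Ω → PhaseSpace N}
    (hX : Measurable X) {G : Ω → ℝ → Fin N → ℝ} (hGc : ∀ w, Continuous (G w))
    (hGm : ∀ t, Measurable fun w => G w t) (t : ℝ) :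
    Measurable fun w => (pinnedChain ω₂ lam β γ).noiseWork N (X w) (G w) t := by
  unfold OscillatorChain.noiseWork
  have hflow := fun s => pinnedChain_measurable_chainFlow hω hl hβ hγ N hX hGc hGm s
  have hYc : Continuous ((pinnedChain ω₂ lam β γ).drift N) :=
    (pinnedChain_contDiff_drift ω₂ lam β γ N (n := 0)).continuous
  have hGi : ∀ s i, Measurable fun w => G w s i := fun s i => (measurable_pi_apply i).comp (hGm s)
  refine Finset.measurable_sum _ fun i _ => ((Measurable.sub ?_ ?_).add ?_)
  · exact (((measurable_pi_apply i).comp (measurable_snd.comp (hflow t))).sub (hGi t i)).mul (hGi t i)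
  · refine measurable_intervalIntegral_of_continuous_of_measurable (fun w => ?_) (fun s => ?_) t
    · have hzc := pinnedChain_continuous_chainFlow hω hl hβ hγ N (X w) (hGc w)
      exact ((continuous_apply i).comp (hGc w)).mul
        ((continuous_apply i).comp (continuous_snd.comp (hYc.comp hzc)))
    · exact (hGi s i).mul ((measurable_pi_apply i).comp (measurable_snd.comp
        (hYc.measurable.comp (hflow s))))
  · exact (hGi t i).pow_const 2 |>.div_const 2

end Pinned

end Literature.MathematicalPhysics.KineticTheory.HeatConduction
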